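/-
Copyright (c) 2026. Released under Apache 2.0 license as described in the file LICENSE.
Track B ∕ K2-LIT (cell `hodgecm-mathlib`, squad K2, ENGINE E1), crux h413 = `stmt-HodgeConjecture-24833`, route of record `HCCMUnconditional`.
Prover seat `hodgecm-mathlib-K2E3-p12` (g6).  Deal «W-hWbd» FILE C3 (FINAL RULING «W5 DIVISION», K2-lead 07:56:16Z): the ASSEMBLED Whittaker function.
-/
import Summits.HodgeConjecture.HodgeConjecture.Theorems.K2E1WhittakerFinitePartU2                     -- ★ p858497 C2 (this seat): `exists_whittakerFinitePart` (the global finite part `W_f`)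
import Summits.HodgeConjecture.HodgeConjecture.Theorems.K2E1WhittakerCoefficientEulerProductAdelicU2  -- ★ p858415 FILE 4 (this seat): `…_eq_prod_cm_two_mellin` (Euler product of the line integral)
import Summits.HodgeConjecture.HodgeConjecture.Theorems.K2E1ArchWhittakerDecayUniformU2              -- ★ p858464 B (K2-defs1): `exists_nhds_forall_norm_prod_archWhittaker_le_exp_neg_norm`, holomorphy
import Summits.HodgeConjecture.HodgeConjecture.Theorems.K2E1WhittakerCoefficientCovarianceU2         -- ★ p858333 W3-cov: `adeleFourierCoeff_bigCellLine_covariance`, `exists_lineIdele`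
import Summits.HodgeConjecture.HodgeConjecture.Theorems.K2E1FractionalIdealAdelicSupport             -- ★ p858439 (K2-defs1): `exists_isCompact_of_forall_eq_zero` (the compact `Cf`)
import Summits.HodgeConjecture.HodgeConjecture.Theorems.K2E1IntertwiningScalarContinuationU2         -- ★ `differentiableOn_zeta_two_mul`, `zeta_two_mul_ne_zero` (`ζ^S(2z)⁻¹` on `Re z > ½`)
import Summits.HodgeConjecture.HodgeConjecture.Theorems.K2E1SphericalEisensteinContinuationU2         -- ★ W5-A p858272: `differentiable_const_cpow_one_sub_of_pos` (`‖d₀‖^{1−z}`)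
import Literature.NumberTheory.Automorphic.AdeleRingTopology                                          -- ★ `infiniteAdeleRingHomeomorph` (= `ringEquiv_mixedSpace`, continuity of the split)
import Literature.NumberTheory.Automorphic.AdelicSecondCountable                                      -- ★ `secondCountableTopology_adeleRing` (Haar uniqueness on `𝔸`)
import HarnessLib

/-!
# K2·E1 — `K2E1WhittakerBoundsAssemblyU2`: THE WHITTAKER FUNCTION `W(z, ξ)` OF THE SPHERICAL EISENSTEIN SERIES ON `U(1,1)_{L∕L⁺}` — ENTIRE PIECES ASSEMBLED,
# LOCALLY UNIFORM BOUND `‖W(z,ξ)‖ ≤ M·e^{−b‖ξ_∞‖}(1+‖ξ_∞‖)^a` WITH COMPACT FINITE SUPPORT, AND `W(z,ξ) = μ(D)⁻¹·𝓕Φ_{g,z}(ξ)` ON `Re z > 1` FOR EVERY HAAR `μ` («W-hWbd» FILE C3 = HEAD)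

Track B ∕ K2-LIT, crux h413 = `stmt-HodgeConjecture-24833`, route of record `HCCMUnconditional`; cell `hodgecm-mathlib`, squad K2, ENGINE E1.  Prover seat `hodgecm-mathlib-K2E3-p12` (g6).
THEOREMS ONLY (no `def`, no `instance`, no notation, no named-fact hypothesis, no `sorry`); lane `--supports stmt-HodgeConjecture-24833 --as helper` (count-neutral).  Closes no socket.

THE MATHEMATICS [MoeglinWaldspurger1995, II.1.7; Bump1997, §3.7; Garrett2018, §1.9–§1.10, §2.8; TateThesis1967, §4.2; WeilBNT1967, Ch. IV §2].  Let `(L⁺, L)` be a CM pair, `δ ∈ L`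
with `δ̄ = −δ ≠ 0`, `f_z = φ₀·H^z` the spherical flat section of `U(1,1)(𝔸_{L⁺})`, `g = n(θx₀)·t₀·k` (Iwasawa, `k ∈ K`, `t₀` diagonal with entries `d₀, d₁`, line idele `α` with
`α ⊗ 1 = d₀⁻¹d₁`, `‖α‖ = ‖d₀‖⁻¹` — ★ `exists_lineIdele`), and `Φ_{g,z}(t) = f_z(ι(w₀)·n(θt)·g)` the big-cell function of W1.  By ★ W3-cov, `𝓕Φ_{g,z}(ξ) = ‖d₀‖^{1−z}·ψ(−ξx₀)·∫ Φ₁(t)ψ(ξα⁻¹t) dμ`;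
by ★ FILE 4 (Euler product through the split Haar measure `μ_s = σ_*(vol ⊗ μ_f)`), `μ_s(D)⁻¹·∫ Φ₁ψ(η·) = (√|d_{L⁺}|)⁻¹·(φ₀·∏_w 𝓦_w(η_w, z))·(∏_{v∈S} W_v(η_v, z))·ζ^S_{L⁺}(2z)⁻¹`
with Mellin-entire archimedean factors `𝓦_w` (★ B) and the global finite part `W_f(z, ξ) = ∏_{v ∈ S(ξ)} W_v` ENTIRE with the box bound and box support (★ C2); Haar uniqueness
(`μ = c·μ_s`) makes `μ(D)⁻¹·𝓕_μ` independent of `μ`.  DEFINE (for `ξ ≠ 0`; `W(z, 0) := 0`, RULING XI-ZERO)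
`W(z, ξ) := ‖d₀‖^{1−z}·ψ(−ξx₀)·((√|d|)⁻¹·(φ₀·∏_w 𝓦_w((ξα⁻¹)_w, z))·(W_f(z, ξ)·ζ^{S(ξ)}(2z)⁻¹))` — a product of functions holomorphic on `Re z > ½` (`ζ^S(2z) ≠ 0` there ★), bounded locally uniformly by
`M·e^{−b·m_α‖ξ_∞‖}·(1+‖ξ_∞‖)^{2[L⁺:ℚ]}` (★ B's `e^{−b‖t‖}` with `‖t‖ ≥ m_α‖ξ_∞‖`, `m_α = min_w |(α⁻¹)_w| > 0`; ★ C2's box bound; ★ `‖ζ^S(2z)⁻¹‖ ≤ C_ζ` uniformly in `S`; `|ψ| = 1`;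
`‖c^{1−z}‖ ≤ c^{1−x₁} + c^{−Re z₀}` on the strip), vanishing unless `(ι ξ)_f` lies in the compact box `∏_v 𝔭_v^{e_v}` (★ `exists_isCompact_of_forall_eq_zero`).
§1 (generic `K`) **`isAddHaarMeasure_map_split`** (the split measure is a Haar measure), **`inv_measure_mul_adeleFourierCoeff_eq_of_isAddHaarMeasure`** (`μ(D)⁻¹·𝓕_μ` is Haar-independent).
§2 (CM pair) **`norm_ofReal_cpow_one_sub_le`**, **`exists_pos_mul_norm_le_norm_lineFreq`** (`m_α‖ξ_∞‖ ≤ ‖((ξα⁻¹)_w)_w‖`), **`snd_units_inv_mul_snd`**.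
§3 **`exists_whittaker_continuation_cm_two`** — THE HEAD: `∃ W`, `W z 0 = 0` ∧ `hWhol` ∧ `hWbd` (★ W5-A p858272 ∕ ★ p858453 bytes, `K := L⁺`) ∧ `hWeq` for EVERY additive Haar `μ` of `𝔸_{L⁺}`
(★ p858500 `sphericalEisenstein_continuation_cm_two_of_whittaker'`'s letters `hWhol hWbd hWeq`; its `hsum` then follows from `hWbd` by ★ W4).
HONEST LABEL: HC_CM is proved only modulo the 7 printed citations (2 remaining named inputs: hLiu418 = `stmt-HodgeConjecture-24832`, h413 = `stmt-HodgeConjecture-24833`) until rung 0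
closes; this file asserts no named fact and closes no socket.
References: [MoeglinWaldspurger1995] II.1.7 · [Bump1997] §3.7 · [Garrett2018] §1.9–§1.10, §2.8 · [TateThesis1967] §4.2 · [WeilBNT1967] Ch. IV §2 · [CasselsFrohlichANT1967] Ch. XV §3.3.
-/

set_option autoImplicit false
-- the mandated namespace repeats the single-problem summit's segment (`HodgeConjecture.HodgeConjecture`)
set_option linter.dupNamespace false

noncomputable section

open MeasureTheory Measure NumberField NumberField.InfinitePlace NumberField.mixedEmbedding IsDedekindDomain IsDedekindDomain.HeightOneSpectrum Set Filter Topology Module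
open scoped ENNReal NNReal Real Classical
open Literature.NumberTheory Literature.NumberTheory.Automorphic Literature.NumberTheory.Automorphic.UnitaryGroup AdelicGroupData
open Literature.NumberTheory.GaloisRepresentations.IsNonarchimedeanLocalField
open Literature.NumberTheory.Automorphic.LocalFieldHaar
open Summit.HodgeConjecture.HodgeConjecture.Cruxes.H413
open Summit.HodgeConjecture.HodgeConjecture.Cruxes.H413.K2E1BorelEisensteinU (flatSectionU)
open Summit.HodgeConjecture.HodgeConjecture.Cruxes.H413.K2E1WhittakerFinitePartU2 (exists_whittakerFinitePart)
open Summit.HodgeConjecture.HodgeConjecture.Cruxes.H413.K2E1WhittakerCoefficientEulerProductAdelicU2 (flatSectionU_const_weylLongU_line_one_eq_cm_two inv_measure_mul_integral_line_mul_adeleAddChar_eq_prod_cm_two_mellin)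
open Summit.HodgeConjecture.HodgeConjecture.Cruxes.H413.K2E1ArchWhittakerDecayUniformU2 (exists_nhds_forall_norm_prod_archWhittaker_le_exp_neg_norm exists_pos_forall_le_pi_div_sqrt differentiableOn_prod_archWhittaker norm_eq_norm_fst_of_isTotallyReal)
open Summit.HodgeConjecture.HodgeConjecture.Cruxes.H413.K2E1WhittakerCoefficientCovarianceU2 (adeleFourierCoeff_bigCellLine_covariance exists_lineIdele)
open Summit.HodgeConjecture.HodgeConjecture.Cruxes.H413.K2E1FractionalIdealAdelicSupport (exists_isCompact_of_forall_eq_zero)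
open Summit.HodgeConjecture.HodgeConjecture.Cruxes.H413.K2E1IntertwiningScalarContinuationU2 (differentiableOn_zeta_two_mul zeta_two_mul_ne_zero)
open Summit.HodgeConjecture.HodgeConjecture.Cruxes.H413.K2E1SphericalEisensteinContinuationU2 (differentiable_const_cpow_one_sub_of_pos)
open Summit.HodgeConjecture.HodgeConjecture.Cruxes.H413.K2E1WhittakerBoundsUniformU2 (norm_inv_partialZeta_two_mul_le_uniform)
open Summit.HodgeConjecture.HodgeConjecture.Cruxes.H413.K2E1AdelicFourierCoeffEulerProductAdelic (ringEquiv_mixedSpace_algebraMap_fst_and_snd)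
open Summit.HodgeConjecture.HodgeConjecture.Cruxes.H413.K2E1HeightBigCellLineFormulaU2 (sq_apply_pos_of_ne_zero)

namespace Summit.HodgeConjecture.HodgeConjecture.Cruxes.H413.K2E1WhittakerBoundsAssemblyU2

/-! ## §1 The split Haar measure; `μ(D)⁻¹·𝓕_μ` does not depend on the Haar measure `μ` (generic number field `K`) -/

section Generic

variable (K : Type) [Field K] [NumberField K]

/-- **The split measure `σ_*(μ_E ⊗ μ_f)` on `𝔸_K` is an additive Haar measure** for Haar measures `μ_E` on `K ⊗ ℝ` and `μ_f` on `𝔸_{K,f}` (`σ(s, b) = (ι⁻¹ s, b)` is a continuous additive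
equivalence: Mathlib `ContinuousAddEquiv.isAddHaarMeasure_map`). [cite: CasselsFrohlichANT1967, Ch. XV §3.3] -/
theorem isAddHaarMeasure_map_split [MeasurableSpace (AdeleRing (𝓞 K) K)] [BorelSpace (AdeleRing (𝓞 K) K)] [MeasurableSpace (FiniteAdeleRing (𝓞 K) K)] [BorelSpace (FiniteAdeleRing (𝓞 K) K)]
    (μE : Measure (mixedSpace K)) [μE.IsAddHaarMeasure] (μf : Measure (FiniteAdeleRing (𝓞 K) K)) [μf.IsAddHaarMeasure]
    {σ : mixedSpace K × FiniteAdeleRing (𝓞 K) K → AdeleRing (𝓞 K) K} (hσ : ∀ p, (σ p).1 = (InfiniteAdeleRing.ringEquiv_mixedSpace K).symm p.1 ∧ (σ p).2 = p.2) :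
    ((μE.prod μf).map σ).IsAddHaarMeasure := by
  haveI := locallyCompactSpace_adeleRing' K
  haveI : SecondCountableTopology (FiniteAdeleRing (𝓞 K) K) := secondCountableTopology_finiteAdeleRing K
  haveI : LocallyCompactSpace (FiniteAdeleRing (𝓞 K) K) := locallyCompactSpace_finiteAdeleRing' K
  haveI : BorelSpace (mixedSpace K × FiniteAdeleRing (𝓞 K) K) := Prod.borelSpace
  haveI : (μE.prod μf).IsAddHaarMeasure := Measure.prod.instIsAddHaarMeasure μE μf
  let ψh : mixedSpace K × FiniteAdeleRing (𝓞 K) K ≃ₜ AdeleRing (𝓞 K) K := (infiniteAdeleRingHomeomorph K).symm.prodCongr (Homeomorph.refl _)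
  let ψA : mixedSpace K × FiniteAdeleRing (𝓞 K) K ≃ₜ+ AdeleRing (𝓞 K) K :=
    ContinuousAddEquiv.mk' ψh fun x y => Prod.ext (map_add (InfiniteAdeleRing.ringEquiv_mixedSpace K).symm x.1 y.1) rfl
  have h : σ = ⇑ψA := funext fun p => Prod.ext (hσ p).1 (hσ p).2
  rw [h]
  exact ContinuousAddEquiv.isAddHaarMeasure_map (μE.prod μf) ψA

/-- **`μ(D)⁻¹·𝓕_μΦ(ξ)` does not depend on the additive Haar measure `μ` of `𝔸_K`**: two Haar measures are proportional (Mathlib `isAddLeftInvariant_eq_smul`, `𝔸_K` second countable ★), and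
both `μ(D)` and `𝓕_μΦ(ξ) = ∫ Φψ(ξ·) dμ` scale by the same positive constant. [cite: CasselsFrohlichANT1967, Ch. XV §3.3] [cite: TateThesis1967, §4.2] -/
theorem inv_measure_mul_adeleFourierCoeff_eq_of_isAddHaarMeasure [MeasurableSpace (AdeleRing (𝓞 K) K)] [BorelSpace (AdeleRing (𝓞 K) K)]
    (μ μ' : Measure (AdeleRing (𝓞 K) K)) [μ.IsAddHaarMeasure] [μ'.IsAddHaarMeasure] (Φ : AdeleRing (𝓞 K) K → ℂ) (ξ : K) :
    ((μ (adeleFundamentalDomain K)).toReal⁻¹ : ℂ) * adeleFourierCoeff μ Φ ξ = ((μ' (adeleFundamentalDomain K)).toReal⁻¹ : ℂ) * adeleFourierCoeff μ' Φ ξ := by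
  haveI := secondCountableTopology_adeleRing K
  haveI := locallyCompactSpace_adeleRing' K
  have hμ : μ = μ.addHaarScalarFactor μ' • μ' := isAddLeftInvariant_eq_smul _ _
  have hc : ((μ.addHaarScalarFactor μ' : ℝ) : ℂ) ≠ 0 := Complex.ofReal_ne_zero.2 (NNReal.coe_ne_zero.2 (addHaarScalarFactor_pos_of_isAddHaarMeasure _ _).ne')
  have h1 : (μ (adeleFundamentalDomain K)).toReal = (μ.addHaarScalarFactor μ' : ℝ) * (μ' (adeleFundamentalDomain K)).toReal := by
    conv_lhs => rw [hμ]
    rw [Measure.smul_apply, ENNReal.toReal_smul, NNReal.smul_def, smul_eq_mul]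
  have h2 : adeleFourierCoeff μ Φ ξ = ((μ.addHaarScalarFactor μ' : ℝ) : ℂ) * adeleFourierCoeff μ' Φ ξ := by
    rw [adeleFourierCoeff_apply, adeleFourierCoeff_apply]
    conv_lhs => rw [hμ]
    rw [integral_smul_nnreal_measure, NNReal.smul_def, Complex.real_smul]
  rw [h1, h2]
  push_cast
  rw [mul_inv, mul_mul_mul_comm, inv_mul_cancel₀ hc, one_mul]

end Generic

/-! ## §2 Three scalar lemmas at the CM pair: the strip bound for `‖d₀‖^{1−z}`, the archimedean frequency `(ξα⁻¹)_∞` dominates `ξ_∞`, `(α⁻¹)_f·(α)_f = 1` -/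

/-- **Strip bound** `‖c^{1−z}‖ = c^{1−Re z} ≤ c^{1−x₁} + c^{1−x₂}` for `c > 0` and `x₁ ≤ Re z ≤ x₂` (monotone in the exponent on either side of `c = 1`). [cite: Garrett2018, §1.10] -/
theorem norm_ofReal_cpow_one_sub_le {c : ℝ} (hc : 0 < c) {x₁ x₂ : ℝ} {z : ℂ} (h₁ : x₁ ≤ z.re) (h₂ : z.re ≤ x₂) :
    ‖(c : ℂ) ^ (1 - z)‖ ≤ c ^ (1 - x₁) + c ^ (1 - x₂) := by
  rw [Complex.norm_cpow_eq_rpow_re_of_pos hc, Complex.sub_re, Complex.one_re]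
  rcases le_total 1 c with hc1 | hc1
  · exact le_add_of_le_of_nonneg (Real.rpow_le_rpow_of_exponent_le hc1 (by linarith)) (Real.rpow_nonneg hc.le _)
  · exact le_add_of_nonneg_of_le (Real.rpow_nonneg hc.le _) (Real.rpow_le_rpow_of_exponent_ge hc hc1 (by linarith))

variable (L : Type) [Field L] [NumberField L] [IsCMField L]
  (hij : (((0 : Fin 2) : ℕ)) + 1 = ((1 : Fin 2) : ℕ)) (hN : 2 = 2 * ((0 : Fin 2) : ℕ) + 2)
  {δ : L} (hcδ : IsCMField.complexConj L δ = -δ) (hδ : δ ≠ 0)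

omit [IsCMField L] in
/-- **The archimedean frequency of W3-cov dominates `ξ_∞`**: for an idele `α` of `L⁺` put `m_α := min_w |((α⁻¹)_∞)_{w⁺}| > 0` (`w` over the places of `L`, `w⁺ = w|_{L⁺}` real); then for every
adele `a`, `m_α·‖ι a_∞‖ ≤ ‖(w ↦ (ι (a·α⁻¹)_∞)_{w⁺})‖` (sup norms; `L⁺` totally real ★ `norm_eq_norm_fst_of_isTotallyReal`, every real place of `L⁺` is some `w⁺`). [cite: Garrett2018, §1.10] -/
theorem exists_pos_mul_norm_le_norm_lineFreq (α : (AdeleRing (𝓞 ↥(maximalRealSubfield L)) ↥(maximalRealSubfield L))ˣ) :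
    ∃ m : ℝ, 0 < m ∧ ∀ a : AdeleRing (𝓞 ↥(maximalRealSubfield L)) ↥(maximalRealSubfield L),
      m * ‖InfiniteAdeleRing.ringEquiv_mixedSpace ↥(maximalRealSubfield L) a.1‖ ≤ ‖fun w : InfinitePlace L => ((InfiniteAdeleRing.ringEquiv_mixedSpace ↥(maximalRealSubfield L) (a * ((α⁻¹ : (AdeleRing (𝓞 ↥(maximalRealSubfield L)) ↥(maximalRealSubfield L))ˣ) : AdeleRing (𝓞 ↥(maximalRealSubfield L)) ↥(maximalRealSubfield L))).1).1 ⟨w.comap (algebraMap ↥(maximalRealSubfield L) L), K2E1HeightBigCellLineFormulaU2.isReal_comap_maximalRealSubfield L w⟩)‖ := by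
  have hmul : ∀ (a b : AdeleRing (𝓞 ↥(maximalRealSubfield L)) ↥(maximalRealSubfield L)) (v : {v : InfinitePlace ↥(maximalRealSubfield L) // v.IsReal}),
      (InfiniteAdeleRing.ringEquiv_mixedSpace ↥(maximalRealSubfield L) (a * b).1).1 v = (InfiniteAdeleRing.ringEquiv_mixedSpace ↥(maximalRealSubfield L) a.1).1 v * (InfiniteAdeleRing.ringEquiv_mixedSpace ↥(maximalRealSubfield L) b.1).1 v := fun a b v => by
    show (InfiniteAdeleRing.ringEquiv_mixedSpace ↥(maximalRealSubfield L) (a.1 * b.1)).1 v = _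
    rw [map_mul, Prod.fst_mul, Pi.mul_apply]
  have hu1 : ∀ v : {v : InfinitePlace ↥(maximalRealSubfield L) // v.IsReal}, (InfiniteAdeleRing.ringEquiv_mixedSpace ↥(maximalRealSubfield L) ((α⁻¹ : (AdeleRing (𝓞 ↥(maximalRealSubfield L)) ↥(maximalRealSubfield L))ˣ) : AdeleRing (𝓞 ↥(maximalRealSubfield L)) ↥(maximalRealSubfield L)).1).1 v * (InfiniteAdeleRing.ringEquiv_mixedSpace ↥(maximalRealSubfield L) ((α : (AdeleRing (𝓞 ↥(maximalRealSubfield L)) ↥(maximalRealSubfield L))ˣ) : AdeleRing (𝓞 ↥(maximalRealSubfield L)) ↥(maximalRealSubfield L)).1).1 v = 1 := fun v => by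
    rw [← hmul, Units.inv_mul]
    show (InfiniteAdeleRing.ringEquiv_mixedSpace ↥(maximalRealSubfield L) 1).1 v = 1
    rw [map_one, Prod.fst_one, Pi.one_apply]
  have hu0 : ∀ v : {v : InfinitePlace ↥(maximalRealSubfield L) // v.IsReal}, (InfiniteAdeleRing.ringEquiv_mixedSpace ↥(maximalRealSubfield L) ((α⁻¹ : (AdeleRing (𝓞 ↥(maximalRealSubfield L)) ↥(maximalRealSubfield L))ˣ) : AdeleRing (𝓞 ↥(maximalRealSubfield L)) ↥(maximalRealSubfield L)).1).1 v ≠ 0 := fun v h => by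
    have h1 := hu1 v
    rw [h, zero_mul] at h1
    exact zero_ne_one h1
  obtain ⟨w₀⟩ := (inferInstance : Nonempty (InfinitePlace L))
  obtain ⟨m, hm⟩ : ∃ m : ℝ, m = Finset.univ.inf' ⟨w₀, Finset.mem_univ _⟩ (fun w : InfinitePlace L => |(InfiniteAdeleRing.ringEquiv_mixedSpace ↥(maximalRealSubfield L) ((α⁻¹ : (AdeleRing (𝓞 ↥(maximalRealSubfield L)) ↥(maximalRealSubfield L))ˣ) : AdeleRing (𝓞 ↥(maximalRealSubfield L)) ↥(maximalRealSubfield L)).1).1 ⟨w.comap (algebraMap ↥(maximalRealSubfield L) L), K2E1HeightBigCellLineFormulaU2.isReal_comap_maximalRealSubfield L w⟩|) := ⟨_, rfl⟩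
  have hmpos : 0 < m := by
    rw [hm, Finset.lt_inf'_iff]
    exact fun w _ => abs_pos.2 (hu0 _)
  have hmle : ∀ w : InfinitePlace L, m ≤ |(InfiniteAdeleRing.ringEquiv_mixedSpace ↥(maximalRealSubfield L) ((α⁻¹ : (AdeleRing (𝓞 ↥(maximalRealSubfield L)) ↥(maximalRealSubfield L))ˣ) : AdeleRing (𝓞 ↥(maximalRealSubfield L)) ↥(maximalRealSubfield L)).1).1 ⟨w.comap (algebraMap ↥(maximalRealSubfield L) L), K2E1HeightBigCellLineFormulaU2.isReal_comap_maximalRealSubfield L w⟩| := fun w => by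
    rw [hm]; exact Finset.inf'_le _ (Finset.mem_univ w)
  refine ⟨m, hmpos, fun a => ?_⟩
  rw [norm_eq_norm_fst_of_isTotallyReal, ← le_div_iff₀' hmpos, pi_norm_le_iff_of_nonneg (div_nonneg (norm_nonneg _) hmpos.le)]
  intro v
  obtain ⟨w, hw⟩ := InfinitePlace.comap_surjective (k := ↥(maximalRealSubfield L)) (K := L) v.1
  have hv : (⟨w.comap (algebraMap ↥(maximalRealSubfield L) L), K2E1HeightBigCellLineFormulaU2.isReal_comap_maximalRealSubfield L w⟩ : {v : InfinitePlace ↥(maximalRealSubfield L) // v.IsReal}) = v := Subtype.ext hw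
  rw [Real.norm_eq_abs, le_div_iff₀' hmpos]
  calc m * |(InfiniteAdeleRing.ringEquiv_mixedSpace ↥(maximalRealSubfield L) a.1).1 v| ≤ |(InfiniteAdeleRing.ringEquiv_mixedSpace ↥(maximalRealSubfield L) ((α⁻¹ : (AdeleRing (𝓞 ↥(maximalRealSubfield L)) ↥(maximalRealSubfield L))ˣ) : AdeleRing (𝓞 ↥(maximalRealSubfield L)) ↥(maximalRealSubfield L)).1).1 v| * |(InfiniteAdeleRing.ringEquiv_mixedSpace ↥(maximalRealSubfield L) a.1).1 v| :=
        mul_le_mul_of_nonneg_right (hv ▸ hmle w) (abs_nonneg _)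
    _ = |(InfiniteAdeleRing.ringEquiv_mixedSpace ↥(maximalRealSubfield L) (a * ((α⁻¹ : (AdeleRing (𝓞 ↥(maximalRealSubfield L)) ↥(maximalRealSubfield L))ˣ) : AdeleRing (𝓞 ↥(maximalRealSubfield L)) ↥(maximalRealSubfield L))).1).1 v| := by rw [hmul, abs_mul, mul_comm]
    _ = ‖(fun w : InfinitePlace L => ((InfiniteAdeleRing.ringEquiv_mixedSpace ↥(maximalRealSubfield L) (a * ((α⁻¹ : (AdeleRing (𝓞 ↥(maximalRealSubfield L)) ↥(maximalRealSubfield L))ˣ) : AdeleRing (𝓞 ↥(maximalRealSubfield L)) ↥(maximalRealSubfield L))).1).1 ⟨w.comap (algebraMap ↥(maximalRealSubfield L) L), K2E1HeightBigCellLineFormulaU2.isReal_comap_maximalRealSubfield L w⟩)) w‖ := by beta_reduce; rw [Real.norm_eq_abs, hv]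
    _ ≤ _ := norm_le_pi_norm (fun w : InfinitePlace L => ((InfiniteAdeleRing.ringEquiv_mixedSpace ↥(maximalRealSubfield L) (a * ((α⁻¹ : (AdeleRing (𝓞 ↥(maximalRealSubfield L)) ↥(maximalRealSubfield L))ˣ) : AdeleRing (𝓞 ↥(maximalRealSubfield L)) ↥(maximalRealSubfield L))).1).1 ⟨w.comap (algebraMap ↥(maximalRealSubfield L) L), K2E1HeightBigCellLineFormulaU2.isReal_comap_maximalRealSubfield L w⟩)) w

omit [IsCMField L] in
/-- `(α⁻¹)_f·(α)_f = 1` in `𝔸_{L⁺,f}` (the finite idele `u = (α⁻¹)_f` of C2 with its inverse `u' = (α)_f`). [folklore] -/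
theorem snd_units_inv_mul_snd (α : (AdeleRing (𝓞 ↥(maximalRealSubfield L)) ↥(maximalRealSubfield L))ˣ) : ((α⁻¹ : (AdeleRing (𝓞 ↥(maximalRealSubfield L)) ↥(maximalRealSubfield L))ˣ) : AdeleRing (𝓞 ↥(maximalRealSubfield L)) ↥(maximalRealSubfield L)).2 * ((α : (AdeleRing (𝓞 ↥(maximalRealSubfield L)) ↥(maximalRealSubfield L))ˣ) : AdeleRing (𝓞 ↥(maximalRealSubfield L)) ↥(maximalRealSubfield L)).2 = 1 := by
  show (((α⁻¹ : (AdeleRing (𝓞 ↥(maximalRealSubfield L)) ↥(maximalRealSubfield L))ˣ) : AdeleRing (𝓞 ↥(maximalRealSubfield L)) ↥(maximalRealSubfield L)) * ((α : (AdeleRing (𝓞 ↥(maximalRealSubfield L)) ↥(maximalRealSubfield L))ˣ) : AdeleRing (𝓞 ↥(maximalRealSubfield L)) ↥(maximalRealSubfield L))).2 = 1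
  rw [Units.inv_mul]
  rfl

/-! ## §3 THE HEAD: the assembled Whittaker function of the spherical Eisenstein series on `U(1,1)_{L∕L⁺}` -/

include hij hN hcδ hδ in
/-- **THE WHITTAKER FUNCTION OF «W5-FINAL» (deal «W-hWbd», head C).**  For the CM pair `(L⁺, L)`, `δ̄ = −δ ≠ 0`, the spherical flat section `f_z = φ₀H^z` and an Iwasawa-decomposed
`g = n(θx₀)·t₀·k` (`t₀` diagonal with idelic entries `d`, `k ∈ K`), there is `W : ℂ → L⁺ → ℂ` with: `W(z, 0) = 0`; `z ↦ W(z, ξ)` holomorphic on `Re z > ½` (`ξ ≠ 0`); the locally uniform bound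
`‖W(z,ξ)‖ ≤ M·e^{−b‖ξ_∞‖}·(1+‖ξ_∞‖)^a` with `W(z, ξ) = 0` off a compact `Cf ⊂ 𝔸_{L⁺,f}` (★ W5-A's `hWbd`, bytes of ★ p858453); and `W(z, ξ) = μ(D)⁻¹·𝓕Φ_{g,z}(ξ)` for `Re z > 1`, `ξ ≠ 0` and EVERY
additive Haar measure `μ` of `𝔸_{L⁺}` (★ p858500's `hWeq`).  Assembly of ★ W3-cov, ★ FILE 4, ★ B, ★ C2, ★ `exists_isCompact_of_forall_eq_zero`, Haar uniqueness.
[cite: MoeglinWaldspurger1995, II.1.7] [cite: Bump1997, §3.7] [cite: Garrett2018, §1.10] [cite: TateThesis1967, §4.2] [cite: WeilBNT1967, Ch. IV §2] -/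
theorem exists_whittaker_continuation_cm_two [MeasurableSpace (AdeleRing (𝓞 ↥(maximalRealSubfield L)) ↥(maximalRealSubfield L))] [BorelSpace (AdeleRing (𝓞 ↥(maximalRealSubfield L)) ↥(maximalRealSubfield L))] (φ₀ : ℂ)
    (t₀ : torusInBorel ↥(maximalRealSubfield L) L (IsCMField.complexConj L) 2) {d : Fin 2 → (AdeleRing (𝓞 L) L)ˣ}
    (hd : glDiagonal 2 (AdeleRing (𝓞 L) L) d = adelicVal ↥(maximalRealSubfield L) L (IsCMField.complexConj L) 2 _ ((t₀ : borelAdelic ↥(maximalRealSubfield L) L (IsCMField.complexConj L) 2) : (quasiSplit (↥(maximalRealSubfield L)) L (IsCMField.complexConj L) 2).Adelic))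
    {x₀ : AdeleRing (𝓞 ↥(maximalRealSubfield L)) ↥(maximalRealSubfield L)} {k g : (quasiSplit (↥(maximalRealSubfield L)) L (IsCMField.complexConj L) 2).Adelic}
    (hk : k ∈ ((standardMaximalCompactGL 2 L).comap (adelicVal ↥(maximalRealSubfield L) L (IsCMField.complexConj L) 2 ((StdForm.antidiagonal 2).over L)) : Subgroup (quasiSplit (↥(maximalRealSubfield L)) L (IsCMField.complexConj L) 2).Adelic))
    (hg : g = ((middleRootUnipotent hij hN (Multiplicative.ofAdd (traceZeroLine ↥(maximalRealSubfield L) L (IsCMField.complexConj L) hcδ hδ x₀)) : ↥(adelicUnipotent (↥(maximalRealSubfield L)) L (IsCMField.complexConj L) 2)) : (quasiSplit (↥(maximalRealSubfield L)) L (IsCMField.complexConj L) 2).Adelic) * ((t₀ : borelAdelic ↥(maximalRealSubfield L) L (IsCMField.complexConj L) 2) : (quasiSplit (↥(maximalRealSubfield L)) L (IsCMField.complexConj L) 2).Adelic) * k) :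
    ∃ W : ℂ → ↥(maximalRealSubfield L) → ℂ,
      (∀ z : ℂ, W z 0 = 0) ∧
      (∀ ξ : ↥(maximalRealSubfield L), ξ ≠ 0 → DifferentiableOn ℂ (fun z => W z ξ) {z : ℂ | 1 / 2 < z.re}) ∧
      (∀ z₀ ∈ {z : ℂ | 1 / 2 < z.re}, ∃ V ∈ 𝓝 z₀, ∃ (M b a : ℝ) (Cf : Set (FiniteAdeleRing (𝓞 ↥(maximalRealSubfield L)) ↥(maximalRealSubfield L))), 0 ≤ M ∧ 0 < b ∧ IsCompact Cf ∧
        ∀ z ∈ V, ∀ ξ : ↥(maximalRealSubfield L), ‖W z ξ‖ ≤ M * Real.exp (-(b * ‖InfiniteAdeleRing.ringEquiv_mixedSpace ↥(maximalRealSubfield L) (algebraMap ↥(maximalRealSubfield L) (AdeleRing (𝓞 ↥(maximalRealSubfield L)) ↥(maximalRealSubfield L)) ξ).1‖)) * (1 + ‖InfiniteAdeleRing.ringEquiv_mixedSpace ↥(maximalRealSubfield L) (algebraMap ↥(maximalRealSubfield L) (AdeleRing (𝓞 ↥(maximalRealSubfield L)) ↥(maximalRealSubfield L)) ξ).1‖)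 ^ a ∧ ((algebraMap ↥(maximalRealSubfield L) (AdeleRing (𝓞 ↥(maximalRealSubfield L)) ↥(maximalRealSubfield L)) ξ).2 ∉ Cf → W z ξ = 0)) ∧
      (∀ (μ : Measure (AdeleRing (𝓞 ↥(maximalRealSubfield L)) ↥(maximalRealSubfield L))) [μ.IsAddHaarMeasure] (z : ℂ), 1 < z.re → ∀ ξ : ↥(maximalRealSubfield L), ξ ≠ 0 →
        W z ξ = ((μ (adeleFundamentalDomain ↥(maximalRealSubfield L))).toReal⁻¹ : ℂ) * adeleFourierCoeff μ (fun t : AdeleRing (𝓞 ↥(maximalRealSubfield L)) ↥(maximalRealSubfield L) => flatSectionU (fun _ : (quasiSplit (↥(maximalRealSubfield L)) L (IsCMField.complexConj L) 2).Adelic => φ₀) z (((quasiSplit (↥(maximalRealSubfield L)) L (IsCMField.complexConj L) 2).toAdelic (weylLongU ((IsCMField.complexConj L : L ≃ₐ[↥(maximalRealSubfield L)] L) : L →+* L) (rfl : ((StdForm.antidiagonal 2).over L) = ((StdForm.antidiagonal 2).over L)))) * ((middleRootUnipotent hij hN (Multiplicative.ofAdd (traceZeroLine ↥(maximalRealSubfield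 L) L (IsCMField.complexConj L) hcδ hδ t)) : ↥(adelicUnipotent (↥(maximalRealSubfield L)) L (IsCMField.complexConj L) 2)) : (quasiSplit (↥(maximalRealSubfield L)) L (IsCMField.complexConj L) 2).Adelic) * g)) ξ) := by
  classical
  haveI := IsCMField.isQuadraticExtension L
  have hcc : IsCMField.complexConj L * IsCMField.complexConj L = 1 := AlgEquiv.ext fun x => IsCMField.complexConj_apply_apply L x
  -- the line idele `α` of `t₀` (★ W3-cov `exists_lineIdele`)
  obtain ⟨α, hα, hα'⟩ := exists_lineIdele hcδ hδ hcc (IsCMField.complexConj_ne_one L) t₀ hd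
  -- measurable structures and Haar measures on `𝔸_{L⁺,f}` and the local fields; the split Haar measure `μ_s = σ_*(vol ⊗ μ_f)`
  letI : MeasurableSpace (FiniteAdeleRing (𝓞 ↥(maximalRealSubfield L)) ↥(maximalRealSubfield L)) := borel _
  haveI : BorelSpace (FiniteAdeleRing (𝓞 ↥(maximalRealSubfield L)) ↥(maximalRealSubfield L)) := ⟨rfl⟩
  letI : ∀ v : HeightOneSpectrum (𝓞 ↥(maximalRealSubfield L)), MeasurableSpace (v.adicCompletion ↥(maximalRealSubfield L)) := fun v => borel _
  haveI : ∀ v : HeightOneSpectrum (𝓞 ↥(maximalRealSubfield L)), BorelSpace (v.adicCompletion ↥(maximalRealSubfield L)) := fun v => ⟨rfl⟩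
  haveI : LocallyCompactSpace (FiniteAdeleRing (𝓞 ↥(maximalRealSubfield L)) ↥(maximalRealSubfield L)) := locallyCompactSpace_finiteAdeleRing' ↥(maximalRealSubfield L)
  obtain ⟨μf, hμf⟩ : ∃ μf : Measure (FiniteAdeleRing (𝓞 ↥(maximalRealSubfield L)) ↥(maximalRealSubfield L)), μf.IsAddHaarMeasure := ⟨Measure.addHaar, inferInstance⟩
  obtain ⟨ν, hν⟩ : ∃ ν : ∀ v : HeightOneSpectrum (𝓞 ↥(maximalRealSubfield L)), Measure (v.adicCompletion ↥(maximalRealSubfield L)), ∀ v, (ν v).IsAddHaarMeasure :=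
    ⟨fun v => Measure.addHaar, fun v => inferInstance⟩
  haveI : ∀ v, (ν v).IsAddHaarMeasure := hν
  obtain ⟨σ, hσ⟩ : ∃ σ : mixedSpace ↥(maximalRealSubfield L) × FiniteAdeleRing (𝓞 ↥(maximalRealSubfield L)) ↥(maximalRealSubfield L) → AdeleRing (𝓞 ↥(maximalRealSubfield L)) ↥(maximalRealSubfield L), ∀ p, (σ p).1 = (InfiniteAdeleRing.ringEquiv_mixedSpace ↥(maximalRealSubfield L)).symm p.1 ∧ (σ p).2 = p.2 :=
    ⟨fun p => ((InfiniteAdeleRing.ringEquiv_mixedSpace ↥(maximalRealSubfield L)).symm p.1, p.2), fun p => ⟨rfl, rfl⟩⟩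
  haveI hμs : (((volume : Measure (mixedSpace ↥(maximalRealSubfield L))).prod μf).map σ).IsAddHaarMeasure := isAddHaarMeasure_map_split ↥(maximalRealSubfield L) volume μf hσ
  -- the global finite part `W_f` (★ C2) at the finite idele `u = (α⁻¹)_f`
  obtain ⟨Wf, S, e, he0, hWfd, hWfeq, hWunr, ⟨Cf₁, hCf₁, hWfbd⟩, hWfz⟩ :=
    exists_whittakerFinitePart (F := ↥(maximalRealSubfield L)) (E := L) hδ ν (snd_units_inv_mul_snd L α)
  -- archimedean data: `c_w = (wδ)² > 0`, the decay rate `b`, the frequency comparison constant `m_α`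
  have hc : ∀ w : InfinitePlace L, 0 < (fun w : InfinitePlace L => (w δ) ^ 2) w := fun w => sq_apply_pos_of_ne_zero L hδ w
  obtain ⟨b, hb, hbw⟩ := exists_pos_forall_le_pi_div_sqrt hc
  obtain ⟨m, hm, hmle⟩ := exists_pos_mul_norm_le_norm_lineFreq L α
  have hpos : (0 : ℝ) < (IdeleClassGroup.ideleNorm L (d 0) : ℝ) := ideleNorm_real_pos _
  -- THE WHITTAKER FUNCTION
  obtain ⟨W, hW⟩ : ∃ W : ℂ → ↥(maximalRealSubfield L) → ℂ, W = fun (z : ℂ) (ξ : ↥(maximalRealSubfield L)) => if ξ = 0 then (0 : ℂ) else ((IdeleClassGroup.ideleNorm L (d 0) : ℝ) : ℂ) ^ (1 - z) * (adeleAddChar ↥(maximalRealSubfield L) (algebraMap ↥(maximalRealSubfield L) (AdeleRing (𝓞 ↥(maximalRealSubfield L)) ↥(maximalRealSubfield L)) ξ * -x₀) : ℂ) * ((((NNReal.sqrt ‖discr ↥(maximalRealSubfield L)‖₊ : ℝ≥0) : ℝ)⁻¹ : ℂ) * (φ₀ * ∏ w : InfinitePlace L, ((Complex.Gamma z)⁻¹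 * ((Real.sqrt (π / (w δ) ^ 2) : ℝ) : ℂ) * mellin (fun t : ℝ => Complex.exp (-(t : ℂ) - ((π ^ 2 * ((InfiniteAdeleRing.ringEquiv_mixedSpace ↥(maximalRealSubfield L) (algebraMap ↥(maximalRealSubfield L) (AdeleRing (𝓞 ↥(maximalRealSubfield L)) ↥(maximalRealSubfield L)) ξ * ((α⁻¹ : (AdeleRing (𝓞 ↥(maximalRealSubfield L)) ↥(maximalRealSubfield L))ˣ) : AdeleRing (𝓞 ↥(maximalRealSubfield L)) ↥(maximalRealSubfield L))).1).1 ⟨w.comap (algebraMap ↥(maximalRealSubfield L) L), K2E1HeightBigCellLineFormulaU2.isReal_comap_maximalRealSubfield L w⟩) ^ 2 / (w δ) ^ 2 : ℝ) : ℂ) / (t : ℂ))) (z - 1 / 2))) * (Wf z ξ * (partialStandardL ((S ξ : Finset (HeightOneSpectrum (𝓞 ↥(maximalRealSubfield L)))) : Set (HeightOneSpectrum (𝓞 ↥(maximalRealSubfield L)))) (fun _ => ({1} : Multiset ℂ)) (2 * z))⁻¹)) := ⟨_, rfl⟩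
  have hWapp : ∀ (z : ℂ) (ξ : ↥(maximalRealSubfield L)), W z ξ = if ξ = 0 then (0 : ℂ) else ((IdeleClassGroup.ideleNorm L (d 0) : ℝ) : ℂ) ^ (1 - z) * (adeleAddChar ↥(maximalRealSubfield L) (algebraMap ↥(maximalRealSubfield L) (AdeleRing (𝓞 ↥(maximalRealSubfield L)) ↥(maximalRealSubfield L)) ξ * -x₀) : ℂ) * ((((NNReal.sqrt ‖discr ↥(maximalRealSubfield L)‖₊ : ℝ≥0) : ℝ)⁻¹ : ℂ) * (φ₀ * ∏ w : InfinitePlace L, ((Complex.Gamma z)⁻¹ * ((Real.sqrt (π / (w δ) ^ 2) : ℝ) : ℂ) * mellin (fun t : ℝ => Complex.exp (-(t : ℂ) - ((π ^ 2 * ((InfiniteAdeleRing.ringEquiv_mixedSpace ↥(maximalRealSubfield L) (algebraMap ↥(maximalRealSubfield L) (AdeleRing (𝓞 ↥(maximalRealSubfield L)) ↥(maximalRealSubfield L)) ξ * ((α⁻¹ : (AdeleRing (𝓞 ↥(maximalRealSubfield L)) ↥(maximalRealSubfield L))ˣ) : AdeleRing (𝓞 ↥(maximalRealSubfield L)) ↥(maximalRealSubfield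 L))).1).1 ⟨w.comap (algebraMap ↥(maximalRealSubfield L) L), K2E1HeightBigCellLineFormulaU2.isReal_comap_maximalRealSubfield L w⟩) ^ 2 / (w δ) ^ 2 : ℝ) : ℂ) / (t : ℂ))) (z - 1 / 2))) * (Wf z ξ * (partialStandardL ((S ξ : Finset (HeightOneSpectrum (𝓞 ↥(maximalRealSubfield L)))) : Set (HeightOneSpectrum (𝓞 ↥(maximalRealSubfield L)))) (fun _ => ({1} : Multiset ℂ)) (2 * z))⁻¹)) := fun z ξ => by rw [hW]
  have hW0 : ∀ z : ℂ, W z 0 = 0 := fun z => by rw [hWapp, if_pos rfl]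
  -- off the box `∏_v 𝔭_v^{e_v}` the function vanishes (★ C2 (supp)); ★ `exists_isCompact_of_forall_eq_zero` packages the compact `Cf`
  have hWz : ∀ (z : ℂ) (ξ : ↥(maximalRealSubfield L)), (∃ v : HeightOneSpectrum (𝓞 ↥(maximalRealSubfield L)), (ξ : v.adicCompletion ↥(maximalRealSubfield L)) ∉ primePowBall (v.adicCompletion ↥(maximalRealSubfield L)) (e v)) → W z ξ = 0 := by
    intro z ξ hξv
    by_cases hξ : ξ = 0
    · rw [hξ, hW0]
    · rw [hWapp, if_neg hξ, hWfz ξ hξ hξv z, zero_mul, mul_zero, mul_zero]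
  obtain ⟨Cf, hCfc, hCfW⟩ := exists_isCompact_of_forall_eq_zero ↥(maximalRealSubfield L) W (e := e) (he0.mono fun v hv => hv.symm.le) hWz
  refine ⟨W, hW0, fun ξ hξ => ?_, fun z₀ hz₀ => ?_, fun μ hμ z hz ξ hξ => ?_⟩
  · -- `hWhol`: a product of functions holomorphic on `Re z > ½`
    have hfun : (fun z => W z ξ) = fun z => ((IdeleClassGroup.ideleNorm L (d 0) : ℝ) : ℂ) ^ (1 - z) * (adeleAddChar ↥(maximalRealSubfield L) (algebraMap ↥(maximalRealSubfield L) (AdeleRing (𝓞 ↥(maximalRealSubfield L)) ↥(maximalRealSubfield L)) ξ * -x₀) : ℂ) * ((((NNReal.sqrt ‖discr ↥(maximalRealSubfield L)‖₊ : ℝ≥0) : ℝ)⁻¹ : ℂ) * (φ₀ * ∏ w : InfinitePlace L, ((Complex.Gamma z)⁻¹ * ((Real.sqrt (π / (w δ) ^ 2) : ℝ) : ℂ) * mellin (fun t : ℝ => Complex.exp (-(t : ℂ) - ((π ^ 2 * ((InfiniteAdeleRing.ringEquiv_mixedSpace ↥(maximalRealSubfield L) (algebraMap ↥(maximalRealSubfield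 L) (AdeleRing (𝓞 ↥(maximalRealSubfield L)) ↥(maximalRealSubfield L)) ξ * ((α⁻¹ : (AdeleRing (𝓞 ↥(maximalRealSubfield L)) ↥(maximalRealSubfield L))ˣ) : AdeleRing (𝓞 ↥(maximalRealSubfield L)) ↥(maximalRealSubfield L))).1).1 ⟨w.comap (algebraMap ↥(maximalRealSubfield L) L), K2E1HeightBigCellLineFormulaU2.isReal_comap_maximalRealSubfield L w⟩) ^ 2 / (w δ) ^ 2 : ℝ) : ℂ) / (t : ℂ))) (z - 1 / 2))) * (Wf z ξ * (partialStandardL ((S ξ : Finset (HeightOneSpectrum (𝓞 ↥(maximalRealSubfield L)))) : Set (HeightOneSpectrum (𝓞 ↥(maximalRealSubfield L)))) (fun _ => ({1} : Multiset ℂ)) (2 * z))⁻¹)) := funext fun z => by rw [hWapp, if_neg hξ]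
    rw [hfun]
    exact (((differentiable_const_cpow_one_sub_of_pos hpos).differentiableOn.mul (differentiableOn_const _)).mul
      (((differentiableOn_const _).mul ((differentiableOn_const _).mul (differentiableOn_prod_archWhittaker hc (fun w : InfinitePlace L => ((InfiniteAdeleRing.ringEquiv_mixedSpace ↥(maximalRealSubfield L) (algebraMap ↥(maximalRealSubfield L) (AdeleRing (𝓞 ↥(maximalRealSubfield L)) ↥(maximalRealSubfield L)) ξ * ((α⁻¹ : (AdeleRing (𝓞 ↥(maximalRealSubfield L)) ↥(maximalRealSubfield L))ˣ) : AdeleRing (𝓞 ↥(maximalRealSubfield L)) ↥(maximalRealSubfield L))).1).1 ⟨w.comap (algebraMap ↥(maximalRealSubfield L) L), K2E1HeightBigCellLineFormulaU2.isReal_comap_maximalRealSubfield L w⟩))))).mul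
        ((hWfd ξ).differentiableOn.mul ((differentiableOn_zeta_two_mul (F := ↥(maximalRealSubfield L)) (S := ((S ξ : Finset (HeightOneSpectrum (𝓞 ↥(maximalRealSubfield L)))) : Set (HeightOneSpectrum (𝓞 ↥(maximalRealSubfield L)))))).inv fun z hz => zeta_two_mul_ne_zero hz))))
  · -- `hWbd`: the locally uniform bound on a neighbourhood of `z₀`, `Re z₀ > ½`
    have hz₀' : 1 / 2 < z₀.re := hz₀
    obtain ⟨x₁, hx₁⟩ : ∃ x₁ : ℝ, x₁ = (1 / 2 + z₀.re) / 2 := ⟨_, rfl⟩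
    have hx₁l : 1 / 2 < x₁ := by rw [hx₁]; linarith
    have hx₁r : x₁ < z₀.re := by rw [hx₁]; linarith
    obtain ⟨V₁, hV₁, C₁, hC₁, hB⟩ := exists_nhds_forall_norm_prod_archWhittaker_le_exp_neg_norm hc hb.le hbw hz₀'
    obtain ⟨Cζ, hCζ, hζ⟩ := norm_inv_partialZeta_two_mul_le_uniform (K := ↥(maximalRealSubfield L)) hx₁l
    refine ⟨V₁ ∩ {z : ℂ | x₁ < z.re} ∩ {z : ℂ | z.re < z₀.re + 1},
      Filter.inter_mem (Filter.inter_mem hV₁ ((Complex.continuous_re.isOpen_preimage _ isOpen_Ioi).mem_nhds hx₁r))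
        ((Complex.continuous_re.isOpen_preimage _ isOpen_Iio).mem_nhds (show z₀.re < z₀.re + 1 by linarith)),
      ((IdeleClassGroup.ideleNorm L (d 0) : ℝ) ^ (1 - x₁) + (IdeleClassGroup.ideleNorm L (d 0) : ℝ) ^ (1 - (z₀.re + 1))) * ‖(((NNReal.sqrt ‖discr ↥(maximalRealSubfield L)‖₊ : ℝ≥0) : ℝ)⁻¹ : ℂ)‖ * ‖φ₀‖ * C₁ * Cf₁ * Cζ,
      b * m, (((2 * finrank ℚ ↥(maximalRealSubfield L) : ℕ)) : ℝ), Cf, by positivity, mul_pos hb hm, hCfc, fun z hz ξ => ⟨?_, hCfW z ξ⟩⟩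
    obtain ⟨⟨hz₁, hzx₁⟩, hzx₂⟩ := hz
    have hzx₁' : x₁ < z.re := hzx₁
    have hzx₂' : z.re < z₀.re + 1 := hzx₂
    have hRHS : 0 ≤ ((IdeleClassGroup.ideleNorm L (d 0) : ℝ) ^ (1 - x₁) + (IdeleClassGroup.ideleNorm L (d 0) : ℝ) ^ (1 - (z₀.re + 1))) * ‖(((NNReal.sqrt ‖discr ↥(maximalRealSubfield L)‖₊ : ℝ≥0) : ℝ)⁻¹ : ℂ)‖ * ‖φ₀‖ * C₁ * Cf₁ * Cζ *
        Real.exp (-(b * m * ‖InfiniteAdeleRing.ringEquiv_mixedSpace ↥(maximalRealSubfield L) (algebraMap ↥(maximalRealSubfield L) (AdeleRing (𝓞 ↥(maximalRealSubfield L)) ↥(maximalRealSubfield L)) ξ).1‖)) * (1 + ‖InfiniteAdeleRing.ringEquiv_mixedSpace ↥(maximalRealSubfield L) (algebraMap ↥(maximalRealSubfield L) (AdeleRing (𝓞 ↥(maximalRealSubfield L)) ↥(maximalRealSubfield L)) ξ).1‖) ^ (((2 * finrank ℚ ↥(maximalRealSubfield L) : ℕ)) : ℝ) := by positivity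
    by_cases hξ : ξ = 0
    · rw [hξ, hW0, norm_zero]
      rw [hξ] at hRHS
      exact hRHS
    by_cases hbox : ∀ v : HeightOneSpectrum (𝓞 ↥(maximalRealSubfield L)), (ξ : v.adicCompletion ↥(maximalRealSubfield L)) ∈ primePowBall (v.adicCompletion ↥(maximalRealSubfield L)) (e v)
    · rw [hWapp, if_neg hξ]
      have h1 : ‖((IdeleClassGroup.ideleNorm L (d 0) : ℝ) : ℂ) ^ (1 - z)‖ ≤ (IdeleClassGroup.ideleNorm L (d 0) : ℝ) ^ (1 - x₁) + (IdeleClassGroup.ideleNorm L (d 0) : ℝ) ^ (1 - (z₀.re + 1)) :=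
        norm_ofReal_cpow_one_sub_le hpos hzx₁'.le hzx₂'.le
      have h2 : ‖(adeleAddChar ↥(maximalRealSubfield L) (algebraMap ↥(maximalRealSubfield L) (AdeleRing (𝓞 ↥(maximalRealSubfield L)) ↥(maximalRealSubfield L)) ξ * -x₀) : ℂ)‖ = 1 := Circle.norm_coe _
      have h6 : Real.exp (-(b * ‖(fun w : InfinitePlace L => ((InfiniteAdeleRing.ringEquiv_mixedSpace ↥(maximalRealSubfield L) (algebraMap ↥(maximalRealSubfield L) (AdeleRing (𝓞 ↥(maximalRealSubfield L)) ↥(maximalRealSubfield L)) ξ * ((α⁻¹ : (AdeleRing (𝓞 ↥(maximalRealSubfield L)) ↥(maximalRealSubfield L))ˣ) : AdeleRing (𝓞 ↥(maximalRealSubfield L)) ↥(maximalRealSubfield L))).1).1 ⟨w.comap (algebraMap ↥(maximalRealSubfield L) L), K2E1HeightBigCellLineFormulaU2.isReal_comap_maximalRealSubfield L w⟩))‖)) ≤ Real.exp (-(b * m * ‖InfiniteAdeleRing.ringEquiv_mixedSpace ↥(maximalRealSubfield L) (algebraMap ↥(maximalRealSubfield L) (AdeleRing (𝓞 ↥(maximalRealSubfield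 L)) ↥(maximalRealSubfield L)) ξ).1‖)) :=
        Real.exp_le_exp.2 (neg_le_neg (by rw [mul_assoc]; exact mul_le_mul_of_nonneg_left (hmle _) hb.le))
      have h3 : ‖∏ w : InfinitePlace L, ((Complex.Gamma z)⁻¹ * ((Real.sqrt (π / (w δ) ^ 2) : ℝ) : ℂ) * mellin (fun t : ℝ => Complex.exp (-(t : ℂ) - ((π ^ 2 * ((InfiniteAdeleRing.ringEquiv_mixedSpace ↥(maximalRealSubfield L) (algebraMap ↥(maximalRealSubfield L) (AdeleRing (𝓞 ↥(maximalRealSubfield L)) ↥(maximalRealSubfield L)) ξ * ((α⁻¹ : (AdeleRing (𝓞 ↥(maximalRealSubfield L)) ↥(maximalRealSubfield L))ˣ) : AdeleRing (𝓞 ↥(maximalRealSubfield L)) ↥(maximalRealSubfield L))).1).1 ⟨w.comap (algebraMap ↥(maximalRealSubfield L) L), K2E1HeightBigCellLineFormulaU2.isReal_comap_maximalRealSubfield L w⟩) ^ 2 / (w δ) ^ 2 : ℝ) : ℂ) / (t : ℂ))) (z - 1 / 2))‖ ≤ C₁ * Real.exp (-(b * m * ‖InfiniteAdeleRing.ringEquiv_mixedSpace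 ↥(maximalRealSubfield L) (algebraMap ↥(maximalRealSubfield L) (AdeleRing (𝓞 ↥(maximalRealSubfield L)) ↥(maximalRealSubfield L)) ξ).1‖)) :=
        (hB z hz₁ (fun w : InfinitePlace L => ((InfiniteAdeleRing.ringEquiv_mixedSpace ↥(maximalRealSubfield L) (algebraMap ↥(maximalRealSubfield L) (AdeleRing (𝓞 ↥(maximalRealSubfield L)) ↥(maximalRealSubfield L)) ξ * ((α⁻¹ : (AdeleRing (𝓞 ↥(maximalRealSubfield L)) ↥(maximalRealSubfield L))ˣ) : AdeleRing (𝓞 ↥(maximalRealSubfield L)) ↥(maximalRealSubfield L))).1).1 ⟨w.comap (algebraMap ↥(maximalRealSubfield L) L), K2E1HeightBigCellLineFormulaU2.isReal_comap_maximalRealSubfield L w⟩))).trans (mul_le_mul_of_nonneg_left h6 hC₁)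
      have h4 : ‖Wf z ξ‖ ≤ Cf₁ * (1 + ‖InfiniteAdeleRing.ringEquiv_mixedSpace ↥(maximalRealSubfield L) (algebraMap ↥(maximalRealSubfield L) (AdeleRing (𝓞 ↥(maximalRealSubfield L)) ↥(maximalRealSubfield L)) ξ).1‖) ^ (2 * finrank ℚ ↥(maximalRealSubfield L)) := by
        have h := hWfbd z (by linarith) ξ hξ hbox
        rwa [← (ringEquiv_mixedSpace_algebraMap_fst_and_snd ↥(maximalRealSubfield L) ξ).1] at h
      have h5 : ‖(partialStandardL ((S ξ : Finset (HeightOneSpectrum (𝓞 ↥(maximalRealSubfield L)))) : Set (HeightOneSpectrum (𝓞 ↥(maximalRealSubfield L)))) (fun _ => ({1} : Multiset ℂ)) (2 * z))⁻¹‖ ≤ Cζ := hζ _ z hzx₁'.le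
      calc ‖((IdeleClassGroup.ideleNorm L (d 0) : ℝ) : ℂ) ^ (1 - z) * (adeleAddChar ↥(maximalRealSubfield L) (algebraMap ↥(maximalRealSubfield L) (AdeleRing (𝓞 ↥(maximalRealSubfield L)) ↥(maximalRealSubfield L)) ξ * -x₀) : ℂ) * ((((NNReal.sqrt ‖discr ↥(maximalRealSubfield L)‖₊ : ℝ≥0) : ℝ)⁻¹ : ℂ) * (φ₀ * ∏ w : InfinitePlace L, ((Complex.Gamma z)⁻¹ * ((Real.sqrt (π / (w δ) ^ 2) : ℝ) : ℂ) * mellin (fun t : ℝ => Complex.exp (-(t : ℂ) - ((π ^ 2 * ((InfiniteAdeleRing.ringEquiv_mixedSpace ↥(maximalRealSubfield L) (algebraMap ↥(maximalRealSubfield L) (AdeleRing (𝓞 ↥(maximalRealSubfield L)) ↥(maximalRealSubfield L)) ξ * ((α⁻¹ : (AdeleRing (𝓞 ↥(maximalRealSubfield L)) ↥(maximalRealSubfield L))ˣ) : AdeleRing (𝓞 ↥(maximalRealSubfield L)) ↥(maximalRealSubfield L))).1).1 ⟨w.comap (algebraMap ↥(maximalRealSubfield L) L), K2E1HeightBigCellLineFormulaU2.isReal_comap_maximalRealSubfield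 L w⟩) ^ 2 / (w δ) ^ 2 : ℝ) : ℂ) / (t : ℂ))) (z - 1 / 2))) * (Wf z ξ * (partialStandardL ((S ξ : Finset (HeightOneSpectrum (𝓞 ↥(maximalRealSubfield L)))) : Set (HeightOneSpectrum (𝓞 ↥(maximalRealSubfield L)))) (fun _ => ({1} : Multiset ℂ)) (2 * z))⁻¹))‖
          = ‖((IdeleClassGroup.ideleNorm L (d 0) : ℝ) : ℂ) ^ (1 - z)‖ * ‖(adeleAddChar ↥(maximalRealSubfield L) (algebraMap ↥(maximalRealSubfield L) (AdeleRing (𝓞 ↥(maximalRealSubfield L)) ↥(maximalRealSubfield L)) ξ * -x₀) : ℂ)‖ * (‖(((NNReal.sqrt ‖discr ↥(maximalRealSubfield L)‖₊ : ℝ≥0) : ℝ)⁻¹ : ℂ)‖ * (‖φ₀‖ * ‖∏ w : InfinitePlace L, ((Complex.Gamma z)⁻¹ * ((Real.sqrt (π / (w δ) ^ 2) : ℝ) : ℂ) * mellin (fun t : ℝ => Complex.exp (-(t : ℂ) - ((π ^ 2 * ((InfiniteAdeleRing.ringEquiv_mixedSpace ↥(maximalRealSubfield L) (algebraMap ↥(maximalRealSubfield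 L) (AdeleRing (𝓞 ↥(maximalRealSubfield L)) ↥(maximalRealSubfield L)) ξ * ((α⁻¹ : (AdeleRing (𝓞 ↥(maximalRealSubfield L)) ↥(maximalRealSubfield L))ˣ) : AdeleRing (𝓞 ↥(maximalRealSubfield L)) ↥(maximalRealSubfield L))).1).1 ⟨w.comap (algebraMap ↥(maximalRealSubfield L) L), K2E1HeightBigCellLineFormulaU2.isReal_comap_maximalRealSubfield L w⟩) ^ 2 / (w δ) ^ 2 : ℝ) : ℂ) / (t : ℂ))) (z - 1 / 2))‖) * (‖Wf z ξ‖ * ‖(partialStandardL ((S ξ : Finset (HeightOneSpectrum (𝓞 ↥(maximalRealSubfield L)))) : Set (HeightOneSpectrum (𝓞 ↥(maximalRealSubfield L)))) (fun _ => ({1} : Multiset ℂ)) (2 * z))⁻¹‖)) := by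
            simp only [norm_mul]
        _ ≤ ((IdeleClassGroup.ideleNorm L (d 0) : ℝ) ^ (1 - x₁) + (IdeleClassGroup.ideleNorm L (d 0) : ℝ) ^ (1 - (z₀.re + 1))) * 1 *
              (‖(((NNReal.sqrt ‖discr ↥(maximalRealSubfield L)‖₊ : ℝ≥0) : ℝ)⁻¹ : ℂ)‖ * (‖φ₀‖ * (C₁ * Real.exp (-(b * m * ‖InfiniteAdeleRing.ringEquiv_mixedSpace ↥(maximalRealSubfield L) (algebraMap ↥(maximalRealSubfield L) (AdeleRing (𝓞 ↥(maximalRealSubfield L)) ↥(maximalRealSubfield L)) ξ).1‖)))) * (Cf₁ * (1 + ‖InfiniteAdeleRing.ringEquiv_mixedSpace ↥(maximalRealSubfield L) (algebraMap ↥(maximalRealSubfield L) (AdeleRing (𝓞 ↥(maximalRealSubfield L)) ↥(maximalRealSubfield L)) ξ).1‖) ^ (2 * finrank ℚ ↥(maximalRealSubfield L)) * Cζ)) := by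
            rw [h2]; gcongr
        _ = ((IdeleClassGroup.ideleNorm L (d 0) : ℝ) ^ (1 - x₁) + (IdeleClassGroup.ideleNorm L (d 0) : ℝ) ^ (1 - (z₀.re + 1))) * ‖(((NNReal.sqrt ‖discr ↥(maximalRealSubfield L)‖₊ : ℝ≥0) : ℝ)⁻¹ : ℂ)‖ * ‖φ₀‖ * C₁ * Cf₁ * Cζ *
              Real.exp (-(b * m * ‖InfiniteAdeleRing.ringEquiv_mixedSpace ↥(maximalRealSubfield L) (algebraMap ↥(maximalRealSubfield L) (AdeleRing (𝓞 ↥(maximalRealSubfield L)) ↥(maximalRealSubfield L)) ξ).1‖)) * (1 + ‖InfiniteAdeleRing.ringEquiv_mixedSpace ↥(maximalRealSubfield L) (algebraMap ↥(maximalRealSubfield L) (AdeleRing (𝓞 ↥(maximalRealSubfield L)) ↥(maximalRealSubfield L)) ξ).1‖) ^ (((2 * finrank ℚ ↥(maximalRealSubfield L) : ℕ)) : ℝ) := by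
            rw [Real.rpow_natCast]; ring
    · rw [hWz z ξ (not_forall.1 hbox), norm_zero]
      exact hRHS
  · -- `hWeq`: Haar uniqueness ⟶ the split Haar measure `μ_s`, ★ W3-cov, ★ FILE 4 §1 under the integral, ★ FILE 4's Euler product with ★ C2's (unr) and (eq)
    have hz' : 1 / 2 < z.re := by linarith
    rw [inv_measure_mul_adeleFourierCoeff_eq_of_isAddHaarMeasure ↥(maximalRealSubfield L) μ (((volume : Measure (mixedSpace ↥(maximalRealSubfield L))).prod μf).map σ),
      adeleFourierCoeff_bigCellLine_covariance hij hN hcδ hδ (((volume : Measure (mixedSpace ↥(maximalRealSubfield L))).prod μf).map σ) t₀ hd hα hα'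
        (φ := fun _ : (quasiSplit (↥(maximalRealSubfield L)) L (IsCMField.complexConj L) 2).Adelic => φ₀) (fun _ _ _ => rfl) (fun _ => rfl) z hk hg ξ]
    simp_rw [flatSectionU_const_weylLongU_line_one_eq_cm_two L hij hN hcδ hδ φ₀ z]
    have hbridge : ∀ (v : HeightOneSpectrum (𝓞 ↥(maximalRealSubfield L))) (t : v.adicCompletion ↥(maximalRealSubfield L)),
        (algebraMap ↥(maximalRealSubfield L) (AdeleRing (𝓞 ↥(maximalRealSubfield L)) ↥(maximalRealSubfield L)) ξ * ((α⁻¹ : (AdeleRing (𝓞 ↥(maximalRealSubfield L)) ↥(maximalRealSubfield L))ˣ) : AdeleRing (𝓞 ↥(maximalRealSubfield L)) ↥(maximalRealSubfield L))).2 v * t = ((ξ : v.adicCompletion ↥(maximalRealSubfield L)) * ((α⁻¹ : (AdeleRing (𝓞 ↥(maximalRealSubfield L)) ↥(maximalRealSubfield L))ˣ) : AdeleRing (𝓞 ↥(maximalRealSubfield L)) ↥(maximalRealSubfield L)).2 v) * t := fun _ _ => rfl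
    have h4 := inv_measure_mul_integral_line_mul_adeleAddChar_eq_prod_cm_two_mellin L hij hN hcδ hδ μf ν hσ φ₀ hz (algebraMap ↥(maximalRealSubfield L) (AdeleRing (𝓞 ↥(maximalRealSubfield L)) ↥(maximalRealSubfield L)) ξ * ((α⁻¹ : (AdeleRing (𝓞 ↥(maximalRealSubfield L)) ↥(maximalRealSubfield L))ˣ) : AdeleRing (𝓞 ↥(maximalRealSubfield L)) ↥(maximalRealSubfield L))) (S ξ)
      (fun v hv => by simp only [hbridge]; exact hWunr ξ hξ v hv z hz')
    simp only [hbridge] at h4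
    rw [hWapp, if_neg hξ, hWfeq ξ hξ z hz', ← h4]
    push_cast
    ring

end Summit.HodgeConjecture.HodgeConjecture.Cruxes.H413.K2E1WhittakerBoundsAssemblyU2

end
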